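import Summits.ResolutionOfSingularities.ResolutionOfSingularities.Theorems.PrimaryDeepClasses
import Literature.AlgebraicGeometry.Resolution.MonomialIdealsRegularParameters
import HarnessLib

/-!
# Primary deep cut — ALGEBRA (lens-4 g47, node «PrimaryDeepCut», slice S2)

Ring-level tools for LAW F:
* (I2) the gap-`e` intersection `𝔪^(ℓ+e) ⊓ 𝔭^ℓ ⊆ 𝔪^e·𝔭^ℓ` for `𝔭 = (u)`, `u` part of a regular system of parameters
  (monomial ideals in a regular system of parameters, [CossartPiltant2019, Prop. 2.1]);
* (T↓) the controlled transform with control `ℓ + e` lies in `𝔭'^ℓ`;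
* (T♯) saturated transport of the level shadow UP along a blow-up step: `g^e·y ∈ σ(𝔍)S + 𝔭' ⇒ y ∈ 𝔍'`;
* passage to the surface `R/𝔭`: images of the shadow in the quotient versus powers of the maximal ideal.
-/

set_option linter.dupNamespace false

open CategoryTheory CategoryTheory.Limits AlgebraicGeometry TopologicalSpace IsLocalRing
open MvPolynomial Literature.AlgebraicGeometry.Resolution Scheme.IdealSheafData
open Summit.ResolutionOfSingularities.ResolutionOfSingularities.Theorems
open ForcedTowerClasses DivergentTowerClasses MonomialTowerClasses
open HugDimensionClasses SurfaceShadowClasses SurfaceShadowKernels AbsoluteContactClasses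
open Summit.ResolutionOfSingularities.ResolutionOfSingularities.Theses

universe u

namespace Summit.ResolutionOfSingularities.ResolutionOfSingularities.Theorems.HugValuationCut

/-! ## §1 (I2) the gap-`e` intersection -/

section Intersection

variable {R : Type u} [CommRing R] {c : ℕ}

/-- a monomial `u^b` lies in `(u)^|b|`. [folklore] -/
theorem uPow_mem_span_range_pow (u : Fin c → R) (b : Fin c → ℕ) :
    CossartPiltant.uPow u b ∈ Ideal.span (Set.range u) ^ (∑ i, b i) := by
  rw [CossartPiltant.span_range_pow_eq_span_uPow]
  exact CossartPiltant.uPow_mem_span_uPow u (by simp only [Set.mem_setOf_eq, le_refl])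

/-- **(I2) GAP-`e` INTERSECTION.** For `u` part of a regular system of parameters of a (regular) local ring and
`𝔭 = (u)`: `𝔪^(ℓ+e) ⊓ 𝔭^ℓ ⊆ 𝔪^e·𝔭^ℓ` (both sides are monomial ideals in a regular system of parameters `x ⊇ u`,
and a monomial of total degree `≥ ℓ + e` and `u`-degree `≥ ℓ` factors as (`u`-part of degree `p ≥ ℓ`) × (rest of
degree `≥ ℓ + e - p`)). [cite: CossartPiltant2019, Prop. 2.1] [cite: Matsumura1987, Thm. 14.2, Thm. 16.2] -/
theorem pow_add_inf_pow_le_pow_mul_pow [IsLocalRing R] {u : Fin c → R} (hu : IsRsopPart u) (ℓ e : ℕ) :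
    maximalIdeal R ^ (ℓ + e) ⊓ Ideal.span (Set.range u) ^ ℓ ≤
      maximalIdeal R ^ e * Ideal.span (Set.range u) ^ ℓ := by
  classical
  haveI := hu.isRegularLocalRing
  obtain ⟨l, x, hd, hx, hxu⟩ := hu.exists_rsop
  have h0 : Ideal.span (Set.range (Fin.append x (fun i : Fin 0 => i.elim0))) = maximalIdeal R := by
    rw [range_fin_append, Set.range_eq_empty (fun i : Fin 0 => _), Set.union_empty, hx]
  have hxr : IsRsopPart x := isRsopPart_centre x (fun i : Fin 0 => i.elim0) h0 hd
  have h𝔭m : Ideal.span (Set.range u) ≤ maximalIdeal R := by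
    rw [Ideal.span_le]
    rintro _ ⟨i, rfl⟩
    rw [SetLike.mem_coe, ← hxu i, ← hx]
    exact Ideal.subset_span ⟨_, rfl⟩
  -- monomial descriptions of `𝔪^(ℓ+e)` and (a monomial ideal containing) `𝔭^ℓ`
  have hmA : maximalIdeal R ^ (ℓ + e) =
      Ideal.span (CossartPiltant.uPow x '' {a : Fin (c + l) → ℕ | ℓ + e ≤ ∑ i, a i}) := by
    rw [← hx]; exact CossartPiltant.span_range_pow_eq_span_uPow x (ℓ + e)
  have hext : ∀ b : Fin c → ℕ,
      CossartPiltant.uPow x (Fin.append b (0 : Fin l → ℕ)) = CossartPiltant.uPow u b := by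
    intro b
    simp only [CossartPiltant.uPow, Fin.prod_univ_add, Fin.append_left, Fin.append_right, Pi.zero_apply,
      pow_zero, Finset.prod_const_one, mul_one, hxu]
  have hpC : Ideal.span (Set.range u) ^ ℓ ≤
      Ideal.span (CossartPiltant.uPow x '' {m : Fin (c + l) → ℕ | ℓ ≤ ∑ s : Fin c, m (Fin.castAdd l s)}) := by
    rw [CossartPiltant.span_range_pow_eq_span_uPow, Ideal.span_le]
    rintro _ ⟨b, hb, rfl⟩
    rw [SetLike.mem_coe, ← hext b]
    refine CossartPiltant.uPow_mem_span_uPow x ?_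
    show ℓ ≤ ∑ s : Fin c, Fin.append b (0 : Fin l → ℕ) (Fin.castAdd l s)
    simp only [Fin.append_left]
    exact hb
  rintro f ⟨hfm, hfp⟩
  have hf' : f ∈ Ideal.span (CossartPiltant.uPow x '' {a : Fin (c + l) → ℕ | ℓ + e ≤ ∑ i, a i}) ⊓
      Ideal.span (CossartPiltant.uPow x '' {m : Fin (c + l) → ℕ | ℓ ≤ ∑ s : Fin c, m (Fin.castAdd l s)}) := by
    refine ⟨?_, hpC hfp⟩
    rw [← hmA]
    exact hfm
  rw [hxr.span_uPow_inf_span_uPow] at hf'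
  refine (Ideal.span_le.mpr ?_) hf'
  rintro _ ⟨w, hw, rfl⟩
  obtain ⟨a, ha, m, hm, rfl⟩ := hw
  rw [Set.mem_setOf_eq] at ha hm
  -- split `w = a ⊔ m` into its `u`-part `mu` and the rest `mw`
  have hsplit : a ⊔ m = Fin.append (fun s => (a ⊔ m) (Fin.castAdd l s)) (0 : Fin l → ℕ) +
      Fin.append (0 : Fin c → ℕ) (fun t => (a ⊔ m) (Fin.natAdd c t)) := by
    funext i
    refine Fin.addCases (motive := fun i => (a ⊔ m) i =
      (Fin.append (fun s => (a ⊔ m) (Fin.castAdd l s)) (0 : Fin l → ℕ) +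
        Fin.append (0 : Fin c → ℕ) (fun t => (a ⊔ m) (Fin.natAdd c t))) i) (fun s => ?_) (fun t => ?_) i
    · simp only [Pi.add_apply, Fin.append_left, Pi.zero_apply, add_zero]
    · simp only [Pi.add_apply, Fin.append_right, Pi.zero_apply, zero_add]
  have hp : ℓ ≤ ∑ s : Fin c, (a ⊔ m) (Fin.castAdd l s) :=
    hm.trans (Finset.sum_le_sum fun s _ => le_sup_right)
  have hpq : ℓ + e ≤ ∑ s : Fin c, (a ⊔ m) (Fin.castAdd l s) + ∑ t : Fin l, (a ⊔ m) (Fin.natAdd c t) := by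
    rw [← Fin.sum_univ_add]
    exact ha.trans (Finset.sum_le_sum fun i _ => le_sup_left)
  have hmu : CossartPiltant.uPow x (Fin.append (fun s => (a ⊔ m) (Fin.castAdd l s)) (0 : Fin l → ℕ)) ∈
      maximalIdeal R ^ (∑ s : Fin c, (a ⊔ m) (Fin.castAdd l s) - ℓ) * Ideal.span (Set.range u) ^ ℓ := by
    have h1 := uPow_mem_span_range_pow u (fun s => (a ⊔ m) (Fin.castAdd l s))
    rw [← hext, ← Nat.sub_add_cancel hp, pow_add] at h1
    exact Ideal.mul_mono_left (Ideal.pow_right_mono h𝔭m _) h1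
  have hmw : CossartPiltant.uPow x (Fin.append (0 : Fin c → ℕ) (fun t => (a ⊔ m) (Fin.natAdd c t))) ∈
      maximalIdeal R ^ (∑ t : Fin l, (a ⊔ m) (Fin.natAdd c t)) := by
    have h1 := uPow_mem_span_range_pow x (Fin.append (0 : Fin c → ℕ) (fun t => (a ⊔ m) (Fin.natAdd c t)))
    rw [hx, Fin.sum_univ_add] at h1
    simpa only [Fin.append_left, Fin.append_right, Pi.zero_apply, Finset.sum_const_zero, zero_add] using h1
  rw [SetLike.mem_coe]
  show CossartPiltant.uPow x (a ⊔ m) ∈ maximalIdeal R ^ e * Ideal.span (Set.range u) ^ ℓ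
  rw [hsplit, CossartPiltant.uPow_add]
  have h4 : maximalIdeal R ^ (∑ s : Fin c, (a ⊔ m) (Fin.castAdd l s) - ℓ) * Ideal.span (Set.range u) ^ ℓ *
      maximalIdeal R ^ (∑ t : Fin l, (a ⊔ m) (Fin.natAdd c t)) ≤ maximalIdeal R ^ e * Ideal.span (Set.range u) ^ ℓ := by
    rw [mul_right_comm, ← pow_add]
    exact Ideal.mul_mono_left (Ideal.pow_le_pow_right (by omega))
  exact h4 (Ideal.mul_mem_mul hmu hmw)

end Intersection

/-! ## §2 (T↓), (T♯): transport of the shadow along an abstract blow-up step with control `ℓ + e` -/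

section Transport

variable {R S : Type u} [CommRing R] [CommRing S] (σ : R →+* S) {c : ℕ} (u : Fin c → R) (u' : Fin c → S)
  (g : S) (hg : g ∈ nonZeroDivisors S) (huu' : ∀ t, σ (u t) = g * u' t) (I : Ideal R) (I' : Ideal S) (ℓ e : ℕ)
  (hI' : ∀ y, y ∈ I' ↔ g ^ (ℓ + e) * y ∈ I.map σ)

include huu' in
/-- `σ(𝔭)S ⊆ g·𝔭'`. [folklore] -/
theorem map_span_le_span_singleton_mul : (Ideal.span (Set.range u)).map σ ≤
    Ideal.span {g} * Ideal.span (Set.range u') := by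
  rw [Ideal.map_span, Ideal.span_le]
  rintro _ ⟨_, ⟨t, rfl⟩, rfl⟩
  rw [SetLike.mem_coe, huu' t]
  exact Ideal.mul_mem_mul (Ideal.mem_span_singleton_self g) (Ideal.subset_span ⟨t, rfl⟩)

include huu' in
/-- **(T↓, image)**: `I ⊆ M^e·𝔭^ℓ` with `σ(M)S ⊆ (g)` gives `σ(I)S ⊆ g^(ℓ+e)·𝔭'^ℓ`. [cite: Hironaka1964, Ch. III §3]
[cite: Matsumura1987, §16 Thm. 16.2] -/
theorem map_le_span_pow_mul_pow {M : Ideal R} (hM : M.map σ ≤ Ideal.span {g})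
    (hIM : I ≤ M ^ e * Ideal.span (Set.range u) ^ ℓ) :
    I.map σ ≤ Ideal.span {g ^ (ℓ + e)} * Ideal.span (Set.range u') ^ ℓ := by
  refine (Ideal.map_mono hIM).trans ?_
  rw [Ideal.map_mul, Ideal.map_pow, Ideal.map_pow]
  refine (Ideal.mul_mono (Ideal.pow_right_mono hM e)
    (Ideal.pow_right_mono (map_span_le_span_singleton_mul σ u u' g huu') ℓ)).trans ?_
  rw [mul_pow, ← mul_assoc, ← pow_add, Ideal.span_singleton_pow, Nat.add_comm e ℓ]

include hg hI' in
/-- **(T↓)**: the controlled transform with control `ℓ + e` lies in `𝔭'^ℓ`. [cite: Hironaka1964, Ch. III §3] -/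
theorem transform_le_pow_of_map_le (h : I.map σ ≤ Ideal.span {g ^ (ℓ + e)} * Ideal.span (Set.range u') ^ ℓ) :
    I' ≤ Ideal.span (Set.range u') ^ ℓ := by
  intro y hy
  obtain ⟨w, hw, hgw⟩ := Ideal.mem_span_singleton_mul.mp (h ((hI' y).mp hy))
  exact ((mul_cancel_left_mem_nonZeroDivisors (pow_mem hg (ℓ + e))).mp hgw) ▸ hw

include hg huu' hI' in
/-- **(T♯) SATURATED TRANSPORT UP.** Let `u'` be quasi-regular with `𝔭' = (u')` saturated with respect to `g^e`,
`I ⊆ 𝔭^ℓ`, and every `σ(f)`, `f ∈ I`, divisible by `g^(ℓ+e)`. If `g^e·y ∈ σ(𝔍)S + 𝔭'` for the level-`ℓ` shadow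
`𝔍` of `I`, then `y` lies in the level-`ℓ` shadow `𝔍'` of the transform `I'`. (For a qualifying `𝔞' ⊇ 𝔭'` the
ideal `σ⁻¹(g^e 𝔞' + 𝔭')` qualifies for `𝔍`: compare coefficients of `σF(u') = g^e·G(u')` by quasi-regularity.)
[cite: Matsumura1987, §16 Thm. 16.2] [cite: Hironaka1964, Ch. III §3] -/
theorem mem_levelShadow_transform_of_pow_mul_mem (hu' : IsQuasiRegular u')
    (hsat : ∀ s, g ^ e * s ∈ Ideal.span (Set.range u') → s ∈ Ideal.span (Set.range u'))
    (hI : I ≤ Ideal.span (Set.range u) ^ ℓ) (hdiv : ∀ f ∈ I, ∃ f'', σ f = g ^ (ℓ + e) * f'') {y : S}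
    (hy : g ^ e * y ∈ (levelShadow (Ideal.span (Set.range u)) I ℓ).map σ ⊔ Ideal.span (Set.range u')) :
    y ∈ levelShadow (Ideal.span (Set.range u')) I' ℓ := by
  classical
  refine Submodule.mem_sInf.mpr ?_
  rintro 𝔞' ⟨h𝔭'𝔞', hI'𝔞'⟩
  -- the ideal `𝔞 = σ⁻¹(g^e·𝔞' + 𝔭')` qualifies for the shadow of `I`
  have h𝔭𝔞 : Ideal.span (Set.range u) ≤ (Ideal.span {g ^ e} * 𝔞' ⊔ Ideal.span (Set.range u')).comap σ := by
    rw [Ideal.span_le]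
    rintro _ ⟨t, rfl⟩
    rw [SetLike.mem_coe, Ideal.mem_comap, huu' t]
    exact Ideal.mem_sup_right (Ideal.mul_mem_left _ _ (Ideal.subset_span ⟨t, rfl⟩))
  have hI𝔞 : I ≤ (Ideal.span {g ^ e} * 𝔞' ⊔ Ideal.span (Set.range u')).comap σ * Ideal.span (Set.range u) ^ ℓ := by
    intro f hf
    obtain ⟨F, hF, hFf⟩ := exists_isHomogeneous_of_mem_span_pow u ℓ (hI hf)
    obtain ⟨f'', hf''⟩ := hdiv f hf
    have hf''I : f'' ∈ I' := by
      rw [hI', ← hf'']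
      exact Ideal.mem_map_of_mem σ hf
    have hf''𝔞 : f'' ∈ 𝔞' * Ideal.span (Set.range u') ^ ℓ := hI'𝔞' hf''I
    obtain ⟨G, hG, hGf⟩ := exists_isHomogeneous_of_mem_span_pow u' ℓ (Ideal.mul_le_left hf''𝔞)
    have hGcoeff : ∀ d, G.coeff d ∈ 𝔞' :=
      coeff_mem_of_eval_mem_mul_pow hu' h𝔭'𝔞' hG (by rw [hGf]; exact hf''𝔞)
    -- `σ(f) = g^ℓ · (σF)(u')`
    have hmapF : map σ F = ∑ d ∈ F.support, monomial d (σ (F.coeff d)) := by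
      conv_lhs => rw [F.as_sum]
      rw [map_sum]
      simp only [map_monomial]
    have hσf : σ f = g ^ ℓ * eval u' (map σ F) := by
      rw [← hFf, hmapF, map_sum]
      conv_lhs => rw [F.as_sum, map_sum, map_sum]
      rw [Finset.mul_sum]
      refine Finset.sum_congr rfl fun d hd => ?_
      have hdeg : d.degree = ℓ := by
        rw [Finsupp.degree_eq_weight_one]; exact hF (mem_support_iff.mp hd)
      rw [eval_monomial_transport σ u u' g huu' ℓ hdeg, eval_monomial, eval_monomial, one_mul]
      ring
    -- hence `(σF)(u') = g^e · G(u')`, and the form `σF - g^e G` of degree `ℓ` vanishes at `u'`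
    have hP0 : eval u' (map σ F - C (g ^ e) * G) = 0 := by
      have h1 : g ^ ℓ * eval u' (map σ F) = g ^ ℓ * (g ^ e * eval u' G) := by
        rw [← hσf, hf'', hGf, pow_add, mul_assoc]
      rw [map_sub, map_mul, eval_C, (mul_cancel_left_mem_nonZeroDivisors (pow_mem hg ℓ)).mp h1, sub_self]
    have hPhom : (map σ F - C (g ^ e) * G).IsHomogeneous ℓ := by
      refine (hF.map σ).sub ?_
      have h2 := (isHomogeneous_C (Fin c) (g ^ e)).mul hG
      rwa [zero_add] at h2
    have hPcoeff := coeff_mem_of_eval_mem_mul_pow hu' (le_refl _) hPhom (by rw [hP0]; exact zero_mem _)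
    rw [← hFf]
    refine eval_mem_mul_span_pow u hF (mem_map_C_iff.mpr fun d => ?_)
    rw [Ideal.mem_comap]
    have h1 := hPcoeff d
    rw [coeff_sub, coeff_map, coeff_C_mul] at h1
    have h2 : σ (F.coeff d) = g ^ e * G.coeff d + (σ (F.coeff d) - g ^ e * G.coeff d) := by ring
    rw [h2]
    exact Submodule.add_mem_sup (Ideal.mul_mem_mul (Ideal.mem_span_singleton_self _) (hGcoeff d)) h1
  have h𝔍𝔞 := levelShadow_le h𝔭𝔞 hI𝔞
  -- use `hy`: `g^e y = g^e a₀ + s`, `a₀ ∈ 𝔞'`, `s ∈ 𝔭'`; saturation gives `y - a₀ ∈ 𝔭' ⊆ 𝔞'`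
  have hle : (levelShadow (Ideal.span (Set.range u)) I ℓ).map σ ⊔ Ideal.span (Set.range u') ≤
      Ideal.span {g ^ e} * 𝔞' ⊔ Ideal.span (Set.range u') :=
    sup_le (Ideal.map_le_iff_le_comap.mpr h𝔍𝔞) le_sup_right
  have hy' := hle hy
  obtain ⟨a, ha, s, hs, hsum⟩ := Submodule.mem_sup.mp hy'
  obtain ⟨a₀, ha₀, rfl⟩ := Ideal.mem_span_singleton_mul.mp ha
  have hs' : g ^ e * (y - a₀) ∈ Ideal.span (Set.range u') := by
    rw [mul_sub, ← hsum, add_sub_cancel_left]; exact hs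
  have hy2 : y = a₀ + (y - a₀) := by ring
  rw [hy2]
  exact add_mem ha₀ (h𝔭'𝔞' (hsat _ hs'))

end Transport

/-! ## §3 Passage to the surface `R/𝔭`: images of ideals versus powers of the maximal ideal -/

section Surface

variable {R : Type u} [CommRing R] [IsLocalRing R] (𝔭 : Ideal R) [IsLocalRing (R ⧸ 𝔭)]

/-- `K̄ ⊆ 𝔪̄^n` in `R/𝔭` iff `K ⊆ 𝔪^n + 𝔭`. [folklore] -/
theorem map_mk_le_pow_iff (K : Ideal R) (n : ℕ) :
    K.map (Ideal.Quotient.mk 𝔭) ≤ maximalIdeal (R ⧸ 𝔭) ^ n ↔ K ≤ maximalIdeal R ^ n ⊔ 𝔭 := by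
  rw [← map_maximalIdeal_of_surjective (Ideal.Quotient.mk 𝔭) Ideal.Quotient.mk_surjective, ← Ideal.map_pow,
    Ideal.map_le_iff_le_comap, Ideal.comap_map_of_surjective _ Ideal.Quotient.mk_surjective,
    ← RingHom.ker_eq_comap_bot, Ideal.mk_ker]

/-- `𝔪̄^n ⊆ K̄` in `R/𝔭` if `𝔪^n ⊆ K`. [folklore] -/
theorem pow_le_map_mk_of_pow_le {K : Ideal R} {n : ℕ} (h : maximalIdeal R ^ n ≤ K) :
    maximalIdeal (R ⧸ 𝔭) ^ n ≤ K.map (Ideal.Quotient.mk 𝔭) := by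
  rw [← map_maximalIdeal_of_surjective (Ideal.Quotient.mk 𝔭) Ideal.Quotient.mk_surjective, ← Ideal.map_pow]
  exact Ideal.map_mono h

end Surface

end Summit.ResolutionOfSingularities.ResolutionOfSingularities.Theorems.HugValuationCut
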